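import Summits.HodgeConjecture.CorCM.MultiFieldWeilSurfaceBlockClosures
import Summits.HodgeConjecture.CorCM.MultiFieldWeilSimpleFamiliesAnyCurves
import HarnessLib

/-!
# MULTI-FIELD WEIL ENGINE — SEPARATED CUBIC TOWERS: any number of cubic towers of simple CM threefolds over their own imaginary quadratic fields, pairwise SEPARATED,
# with simple CM surfaces up to the dihedral-triple limit and any CM elliptic curves — the Hodge conjecture for every product of copies, given ONLY Markman's fourfold theorem

Cell `pub-hodgecm2` (COR-CM), seat b30 gen 35 (2026-08-25); count-neutral own lane MULTI-FIELD WEIL ENGINE (stem `MultiFieldWeil*`), sequel of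
`CorCM/MultiFieldWeilSeparatedThreefoldBlocks.lean` (separated blocks split, unconditional) with gen 34's `CorCM/MultiFieldWeilSimpleFamiliesAnyCurves.lean` (N8: ONE cubic
tower × any curves) as the block supplier.  Theorems only; no definition, no named fact, no `sorry`.  HONEST FRAMING: conditional on the displayed Markman fourfold binder
only; `HC_CM` is NOT proved and not asserted.

THE STATEMENT (**`hodgeConjectureFor_prod_of_separatedTowers_of_markman`**).  `A_i ⊨ (K_i; Φ_i)` (`i ∈ I` finite, one index type) SIMPLE of dimension `≤ 3`; `b : I → C` a
labelling; for every label `c` the sextic slots of label `c` are enumerated as a CUBIC TOWER `e_c : Fin r_c → I` over an imaginary quadratic field `k_c`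
(`i_c m : k_c ↪ K_{e_c m}`, a reference embedding `τ_c`, lifts `s_c m`, and N8's tower condition: no `τ_c`-embedding of `K_{e_c m}` lands in
`ℚ(τ_c k_c) · s_c 0(K_{e_c 0}) ⋯ s_c (m−1)(K_{e_c (m−1)})`); differently labelled sextic slots are SEPARATED (different Galois closures, no common imaginary quadratic subfield —
or, §3, the test `k_c ↪̸ K_{e_{c′} m′}` and `L_{e_c m} ≠ L_{e_{c′} m′}`); (iii′) no dihedral surface triple; any quadratic slots.  Then the Hodge conjecture holds for every
product of copies `⨁_j A_{π j}`, GIVEN ONLY `Markman2025_weilClasses_algebraic_abelianFourfold`.  This relaxes gen 33's S4 (`CorCM/MultiFieldWeilSimpleThreefoldsBlocks.lean`: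
towers over several `k` whose closure-composita are pairwise FOREIGN) to SEPARATED towers, and adds the surfaces.

PROOF.  §1 THE TOWER BLOCK: a product of copies whose members are curves or tower members is, slot by slot, a product of copies of N8's family `Sum.elim T E` with
`T m = A_{e m}` (slot map `I → Fin r ⊕ {curves}`), so N8 applies.  §2: `hodgeConjectureFor_prod_of_separatedLabels` with §1 on the block of each label (a sextic member of
the block of `c` has label `c`, `label_eq_of_ringHom_ringHom`, hence is some `e_c m`) and gen 35's `hodgeConjectureFor_prod_surfaceBlock_of_closures` on the block `none`.
§3: the separation test (a sextic field has at most one quadratic subfield).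

[cite: MoonenZarhin1999LowDim, Thm. (0.1), Thm. (0.2), §3 (3.1), Cor. (3.9), §5 (5.2)] [cite: Markman2025SurveySecant, Thm. 1.2] [cite: Gordon1999HodgeAVSurvey, §3 Theorem (proof), 7.4–7.7, 10.10]
[cite: Shimura1998, §8.2 Prop. 26, §8.4 (2), §18.2 Lemma (i)] [cite: Lang2002, VI §1 Thm. 1.1 and Cor. 1.6] [cite: MumfordAV1970, §19 Thm. 1 and p. 169]

## References
* [MoonenZarhin1999LowDim] B. Moonen, Yu. Zarhin, Math. Ann. 315 (1999) 711–733.  [Markman2025SurveySecant] E. Markman, arXiv:2509.23403, Thm. 1.2.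
  [Gordon1999HodgeAVSurvey] B. B. Gordon, *A survey of the Hodge conjecture for abelian varieties*, §3, 7.4–7.7, 10.10.  [Shimura1998] G. Shimura, *Abelian varieties with
  complex multiplication and modular functions*, §8.2, §8.4, §18.2.  [Lang2002] S. Lang, *Algebra*, GTM 211, VI §1.  [MumfordAV1970] D. Mumford, *Abelian Varieties*, §19.
-/

noncomputable section

open CategoryTheory CategoryTheory.Limits NumberField IntermediateField

namespace Summit.HodgeConjecture.CorCM.MultiFieldWeil

open Literature.AlgebraicGeometry Literature.AlgebraicGeometry.Motives Literature.AlgebraicGeometry.HodgeTheory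
open Literature.AlgebraicGeometry.ComplexMultiplication (IsCMTypeRealisation)
open Literature.AlgebraicTopology.SingularHomology
open Literature.NumberTheory.ComplexMultiplication
open Literature.AlgebraicGeometry.Pohlmann1968

open scoped Classical

section Family

variable {I : Type} [Fintype I] {K : I → Type} [∀ i, Field (K i)] [∀ i, NumberField (K i)] [∀ i, IsCMField (K i)]
  {Φ : ∀ i, CMType (K i)} {A : I → AbelianVariety ℂ} {ι : ∀ i, 𝓞 (K i) →+* End (A i)} {θ : ∀ i, K i →+* Module.End ℂ (complexBetti (A i).X 1)}
  {C : Type}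

omit [Fintype I] [∀ i, IsCMField (K i)] in
/-- The CM field of a realisation of dimension `≤ 3` has degree `2`, `4` or `6`. [cite: Shimura1998, §5.2] -/
private theorem finrank_eq_or_of_dim_le_three₃₅t (hA : ∀ i, IsCMTypeRealisation (Φ i) (A i) (ι i) (θ i)) {i : I} (h3 : (A i).dim ≤ 3) :
    Module.finrank ℚ (K i) = 2 ∨ Module.finrank ℚ (K i) = 4 ∨ Module.finrank ℚ (K i) = 6 := by
  have h := finrank_eq_two_mul_dim_of_isCMTypeRealisation (hA i)
  have hpos : 0 < Module.finrank ℚ (K i) := Module.finrank_pos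
  interval_cases hd : (A i).dim <;> omega

omit [Fintype I] [∀ i, IsCMField (K i)] in
/-- An embedding of number fields `K_i ↪ K_t` makes `[K_i : ℚ]` divide `[K_t : ℚ]`. [cite: Shimura1998, §8.1] -/
private theorem finrank_dvd_of_ringHom₃₅t {i t : I} (g : K i →+* K t) : Module.finrank ℚ (K i) ∣ Module.finrank ℚ (K t) := by
  have h1 : Module.finrank ℚ ↥g.toRatAlgHom.fieldRange = Module.finrank ℚ (K i) :=
    ((AlgEquiv.ofInjectiveField g.toRatAlgHom).toLinearEquiv.finrank_eq).symm
  rw [← h1, ← IntermediateField.finrank_top' (F := ℚ) (E := K t)]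
  exact IntermediateField.finrank_dvd_of_le_right le_top

/-! ## §1 The tower block -/

/-- **THE TOWER BLOCK.**  `A_i ⊨ (K_i; Φ_i)` simple; `e : Fin r → I` (`r > 0`) sextic slots forming a CUBIC TOWER over the imaginary quadratic field `k` (N8's data:
`i m : k ↪ K_{e m}`, reference embedding `τ`, lifts `s m` of `τ`, tower condition `htower`); a product of copies `⨁_l A_{ρ l}` every member of which is a CM elliptic curve or
some `A_{e m}`.  Then the Hodge conjecture holds for it, GIVEN ONLY Markman's fourfold theorem — slot by slot it is a product of copies of N8's family
`Sum.elim (A ∘ e) (curves)`, and `hodgeConjectureFor_prod_simpleThreefolds_of_cubicTower_anyCurves_of_markman` applies.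
[cite: MoonenZarhin1999LowDim, Thm. (0.1) (a), §3 (3.1)] [cite: Markman2025SurveySecant, Thm. 1.2] [cite: Shimura1998, §18.2 Lemma (i)] -/
theorem hodgeConjectureFor_prod_towerBlock_of_markman (hW4 : Markman2025_weilClasses_algebraic_abelianFourfold)
    (hA : ∀ i, IsCMTypeRealisation (Φ i) (A i) (ι i) (θ i)) (hS : ∀ i, (A i).IsSimple) {r : ℕ} (hr : 0 < r) (e : Fin r → I)
    (h6 : ∀ m, Module.finrank ℚ (K (e m)) = 6) {k : Type} [Field k] [NumberField k] [IsCMField k] (h2 : Module.finrank ℚ k = 2) (i : ∀ m, k →+* K (e m))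
    (τ : k →+* ℂ) (s : ∀ m, K (e m) →+* ℂ) (hs : ∀ m, (s m).comp (i m) = τ)
    (htower : ∀ (m : Fin r) (φ : K (e m) →+* ℂ), φ.comp (i m) = τ →
      ¬ Set.range φ ⊆ (↑(adjoin ℚ (Set.range τ) ⊔ adjoin ℚ (⋃ j : {j : Fin r // j < m}, Set.range (s j.1))) : Set ℂ))
    {M : ℕ} (ρ : Fin M → I) (hρ : ∀ l, Module.finrank ℚ (K (ρ l)) = 2 ∨ ∃ m, ρ l = e m) :
    HodgeConjectureFor (⨁ fun l => A (ρ l)).dim (⨁ fun l => A (ρ l)).X := by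
  -- the curve slots and the slot map onto `Fin r ⊕ Ic`
  let Ic : Type := {x : I // Module.finrank ℚ (K x) = 2}
  let σ : I → Fin r ⊕ Ic := fun x =>
    if h : Module.finrank ℚ (K x) = 2 then Sum.inr ⟨x, h⟩ else if h' : ∃ m, x = e m then Sum.inl (Classical.choose h') else Sum.inl ⟨0, hr⟩
  have hσ : ∀ x, (Module.finrank ℚ (K x) = 2 ∨ ∃ m, x = e m) → A x = (Sum.elim (fun m => A (e m)) (fun c : Ic => A c.1) (σ x) : AbelianVariety ℂ) := by
    intro x hx
    by_cases h : Module.finrank ℚ (K x) = 2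
    · simp only [σ, dif_pos h, Sum.elim_inr]
    · have h' : ∃ m, x = e m := hx.resolve_left h
      simp only [σ, dif_neg h, dif_pos h', Sum.elim_inl]
      exact congrArg A (Classical.choose_spec h')
  have hfam : (fun l => A (ρ l)) = fun l => (Sum.elim (fun m => A (e m)) (fun c : Ic => A c.1) (σ (ρ l)) : AbelianVariety ℂ) := funext fun l => hσ (ρ l) (hρ l)
  rw [hfam]
  exact hodgeConjectureFor_prod_simpleThreefolds_of_cubicTower_anyCurves_of_markman (K := fun m => K (e m)) (T := fun m => A (e m)) (Φ := fun m => Φ (e m))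
    (ι := fun m => ι (e m)) (θ := fun m => θ (e m)) (kq := fun c : Ic => K c.1) (E := fun c : Ic => A c.1) (Ψ := fun c : Ic => Φ c.1) (ιE := fun c : Ic => ι c.1)
    (θE := fun c : Ic => θ c.1) hW4 h2 h6 i (fun m => hA (e m)) (fun m => hS (e m)) τ s hs htower (fun c => c.2) (fun c => hA c.1) hr fun l => σ (ρ l)

/-! ## §2 Separated towers, surfaces under (iii′), any curves -/

variable {r : C → ℕ} {kc : C → Type} [∀ c, Field (kc c)] [∀ c, NumberField (kc c)] [∀ c, IsCMField (kc c)]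

/-- **MAIN THEOREM — SEPARATED CUBIC TOWERS, SURFACES UP TO THE DIHEDRAL-TRIPLE LIMIT, ANY CURVES, given ONLY Markman's fourfold theorem.**  `A_i ⊨ (K_i; Φ_i)` (`i ∈ I` finite)
SIMPLE of dimension `≤ 3`; `b : I → C`; for each label `c` the sextic slots of label `c` are among `e_c : Fin r_c → I`, a cubic tower over `k_c` (N8's data); differently labelled
sextic slots SEPARATED; (iii′) among any three quartic slots with one Galois closure two carry isogenous surfaces; any quadratic slots.  Then the Hodge conjecture holds for
every product of copies `⨁_j A_{π j}`.  `HC_CM` is NOT asserted. [cite: MoonenZarhin1999LowDim, Thm. (0.1), Thm. (0.2), §3 (3.1), Cor. (3.9)]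
[cite: Markman2025SurveySecant, Thm. 1.2] [cite: Gordon1999HodgeAVSurvey, §3 Theorem (proof), 7.5–7.7, 10.10] -/
theorem hodgeConjectureFor_prod_of_separatedTowers_of_markman (hW4 : Markman2025_weilClasses_algebraic_abelianFourfold)
    (hA : ∀ i, IsCMTypeRealisation (Φ i) (A i) (ι i) (θ i)) (hS : ∀ i, (A i).IsSimple) (h3 : ∀ i, (A i).dim ≤ 3) (b : I → C)
    (hsep : ∀ t t', Module.finrank ℚ (K t) = 6 → Module.finrank ℚ (K t') = 6 → b t ≠ b t' →
      normalClosure ℚ (K t) ℂ ≠ normalClosure ℚ (K t') ℂ ∧ ¬ ∃ F : IntermediateField ℚ (K t), Module.finrank ℚ F = 2 ∧ IsTotallyComplex F ∧ Nonempty (F →+* K t'))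
    (e : ∀ c, Fin (r c) → I) (h6 : ∀ c m, Module.finrank ℚ (K (e c m)) = 6) (hcov : ∀ t, Module.finrank ℚ (K t) = 6 → ∃ m, t = e (b t) m)
    (h2c : ∀ c, Module.finrank ℚ (kc c) = 2) (i : ∀ c m, kc c →+* K (e c m)) (τ : ∀ c, kc c →+* ℂ) (s : ∀ c m, K (e c m) →+* ℂ)
    (hs : ∀ c m, (s c m).comp (i c m) = τ c)
    (htower : ∀ c (m : Fin (r c)) (φ : K (e c m) →+* ℂ), φ.comp (i c m) = τ c →
      ¬ Set.range φ ⊆ (↑(adjoin ℚ (Set.range (τ c)) ⊔ adjoin ℚ (⋃ j : {j : Fin (r c) // j < m}, Set.range (s c j.1))) : Set ℂ))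
    (hS3 : ∀ x y z : I, Module.finrank ℚ (K x) = 4 → Module.finrank ℚ (K y) = 4 → Module.finrank ℚ (K z) = 4 →
      normalClosure ℚ (K x) ℂ = normalClosure ℚ (K y) ℂ → normalClosure ℚ (K y) ℂ = normalClosure ℚ (K z) ℂ →
      AbelianVariety.IsIsogenous (A x) (A y) ∨ AbelianVariety.IsIsogenous (A x) (A z) ∨ AbelianVariety.IsIsogenous (A y) (A z))
    {N : ℕ} (π : Fin N → I) : HodgeConjectureFor (⨁ fun j => A (π j)).dim (⨁ fun j => A (π j)).X := by
  refine hodgeConjectureFor_prod_of_separatedLabels hA hS h3 b hsep (fun c M ρ hρ => ?_) (fun M ρ hρ => ?_) π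
  · -- the block of the label `c`: curves and members of the tower `e c`
    cases M with
    | zero => exact hodgeConjectureFor_of_isDivisorGenerated _ (isDivisorGenerated_of_dim_eq_zero _ (dim_biproduct_fin_zero _))
    | succ M =>
      -- a sextic slot of label `c` exists, so the tower `e c` is not empty
      obtain ⟨t, ht, -, hbt⟩ := hρ 0
      have hr : 0 < r c := by
        obtain ⟨m₀, -⟩ := hcov t ht
        rw [← hbt]
        exact m₀.pos
      refine hodgeConjectureFor_prod_towerBlock_of_markman hW4 hA hS hr (e c) (h6 c) (h2c c) (i c) (τ c) (s c) (hs c) (htower c) ρ fun l => ?_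
      obtain ⟨t', ht', ⟨g⟩, hbt'⟩ := hρ l
      rcases finrank_eq_or_of_dim_le_three₃₅t hA (h3 (ρ l)) with h2 | h4 | h6'
      · exact Or.inl h2
      · exfalso
        have h := finrank_dvd_of_ringHom₃₅t g
        rw [h4, ht'] at h
        omega
      · -- a threefold through `K_{t'}` has the label of `t'`, i.e. `c`; it is a member of the tower `e c`
        have hb : b (ρ l) = c := (label_eq_of_ringHom_ringHom hA h3 b hsep h6' ht' (RingHom.id _) g).trans hbt'
        subst hb
        exact Or.inr (hcov (ρ l) h6')
  · exact hodgeConjectureFor_prod_surfaceBlock_of_closures hA hS h3 hS3 ρ fun l h6' => hρ l ⟨ρ l, h6', ⟨RingHom.id _⟩⟩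

/-- **Dominated form.** [cite: MoonenZarhin1999LowDim, Thm. (0.1), (0.2)] [cite: Markman2025SurveySecant, Thm. 1.2] [cite: MumfordAV1970, §19 Thm. 1 and p. 169] -/
theorem hodgeConjectureFor_of_avDominatedBy_prod_of_separatedTowers_of_markman (hW4 : Markman2025_weilClasses_algebraic_abelianFourfold)
    (hA : ∀ i, IsCMTypeRealisation (Φ i) (A i) (ι i) (θ i)) (hS : ∀ i, (A i).IsSimple) (h3 : ∀ i, (A i).dim ≤ 3) (b : I → C)
    (hsep : ∀ t t', Module.finrank ℚ (K t) = 6 → Module.finrank ℚ (K t') = 6 → b t ≠ b t' →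
      normalClosure ℚ (K t) ℂ ≠ normalClosure ℚ (K t') ℂ ∧ ¬ ∃ F : IntermediateField ℚ (K t), Module.finrank ℚ F = 2 ∧ IsTotallyComplex F ∧ Nonempty (F →+* K t'))
    (e : ∀ c, Fin (r c) → I) (h6 : ∀ c m, Module.finrank ℚ (K (e c m)) = 6) (hcov : ∀ t, Module.finrank ℚ (K t) = 6 → ∃ m, t = e (b t) m)
    (h2c : ∀ c, Module.finrank ℚ (kc c) = 2) (i : ∀ c m, kc c →+* K (e c m)) (τ : ∀ c, kc c →+* ℂ) (s : ∀ c m, K (e c m) →+* ℂ)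
    (hs : ∀ c m, (s c m).comp (i c m) = τ c)
    (htower : ∀ c (m : Fin (r c)) (φ : K (e c m) →+* ℂ), φ.comp (i c m) = τ c →
      ¬ Set.range φ ⊆ (↑(adjoin ℚ (Set.range (τ c)) ⊔ adjoin ℚ (⋃ j : {j : Fin (r c) // j < m}, Set.range (s c j.1))) : Set ℂ))
    (hS3 : ∀ x y z : I, Module.finrank ℚ (K x) = 4 → Module.finrank ℚ (K y) = 4 → Module.finrank ℚ (K z) = 4 →
      normalClosure ℚ (K x) ℂ = normalClosure ℚ (K y) ℂ → normalClosure ℚ (K y) ℂ = normalClosure ℚ (K z) ℂ →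
      AbelianVariety.IsIsogenous (A x) (A y) ∨ AbelianVariety.IsIsogenous (A x) (A z) ∨ AbelianVariety.IsIsogenous (A y) (A z))
    {N : ℕ} (π : Fin N → I) {X : AbelianVariety ℂ} (hX : Domination.AVDominatedBy X (⨁ fun j => A (π j))) : HodgeConjectureFor X.dim X.X :=
  Domination.hodgeConjectureFor_of_avDominatedBy
    (hodgeConjectureFor_prod_of_separatedTowers_of_markman hW4 hA hS h3 b hsep e h6 hcov h2c i τ s hs htower hS3 π) hX

/-! ## §3 With the separation test `k_c ↪̸ K_{e_{c′} m′}`, `L_{e_c m} ≠ L_{e_{c′} m′}` -/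

/-- **SEPARATED CUBIC TOWERS by the concrete test**: across labels `c ≠ c′`, `k_c` does not embed in any `K_{e_{c′} m′}` and the Galois closures of `K_{e_c m}`, `K_{e_{c′} m′}`
differ.  Then everything in §2 holds (a sextic field has at most one quadratic subfield).  `HC_CM` is NOT asserted. [cite: MoonenZarhin1999LowDim, Thm. (0.1), Thm. (0.2), §3 (3.1)]
[cite: Markman2025SurveySecant, Thm. 1.2] [cite: Lang2002, VI §1 Thm. 1.1 and Cor. 1.6] -/
theorem hodgeConjectureFor_prod_of_quadraticSeparatedTowers_of_markman (hW4 : Markman2025_weilClasses_algebraic_abelianFourfold)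
    (hA : ∀ i, IsCMTypeRealisation (Φ i) (A i) (ι i) (θ i)) (hS : ∀ i, (A i).IsSimple) (h3 : ∀ i, (A i).dim ≤ 3) (b : I → C)
    (e : ∀ c, Fin (r c) → I) (h6 : ∀ c m, Module.finrank ℚ (K (e c m)) = 6) (hcov : ∀ t, Module.finrank ℚ (K t) = 6 → ∃ m, t = e (b t) m)
    (h2c : ∀ c, Module.finrank ℚ (kc c) = 2) (i : ∀ c m, kc c →+* K (e c m)) (τ : ∀ c, kc c →+* ℂ) (s : ∀ c m, K (e c m) →+* ℂ)
    (hs : ∀ c m, (s c m).comp (i c m) = τ c)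
    (htower : ∀ c (m : Fin (r c)) (φ : K (e c m) →+* ℂ), φ.comp (i c m) = τ c →
      ¬ Set.range φ ⊆ (↑(adjoin ℚ (Set.range (τ c)) ⊔ adjoin ℚ (⋃ j : {j : Fin (r c) // j < m}, Set.range (s c j.1))) : Set ℂ))
    (hne : ∀ c c' (m : Fin (r c)) (m' : Fin (r c')), c ≠ c' →
      normalClosure ℚ (K (e c m)) ℂ ≠ normalClosure ℚ (K (e c' m')) ℂ ∧ IsEmpty (kc c →+* K (e c' m')))
    (hS3 : ∀ x y z : I, Module.finrank ℚ (K x) = 4 → Module.finrank ℚ (K y) = 4 → Module.finrank ℚ (K z) = 4 →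
      normalClosure ℚ (K x) ℂ = normalClosure ℚ (K y) ℂ → normalClosure ℚ (K y) ℂ = normalClosure ℚ (K z) ℂ →
      AbelianVariety.IsIsogenous (A x) (A y) ∨ AbelianVariety.IsIsogenous (A x) (A z) ∨ AbelianVariety.IsIsogenous (A y) (A z))
    {N : ℕ} (π : Fin N → I) : HodgeConjectureFor (⨁ fun j => A (π j)).dim (⨁ fun j => A (π j)).X := by
  have hcov' : ∀ t, Module.finrank ℚ (K t) = 6 → ∃ c, ∃ m : Fin (r c), t = e c m ∧ b t = c := fun t ht => by
    obtain ⟨m, hm⟩ := hcov t ht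
    exact ⟨b t, m, hm, rfl⟩
  refine hodgeConjectureFor_prod_of_separatedTowers_of_markman hW4 hA hS h3 b (fun t t' ht ht' hbt => ?_) e h6 hcov h2c i τ s hs htower hS3 π
  obtain ⟨c, m, rfl, hbc⟩ := hcov' t ht
  obtain ⟨c', m', rfl, hbc'⟩ := hcov' t' ht'
  have hcc : c ≠ c' := fun h => hbt (by rw [hbc, hbc', h])
  refine ⟨(hne c c' m m' hcc).1, ?_⟩
  rintro ⟨F, hF2, -, ⟨g⟩⟩
  obtain ⟨φ⟩ := WeilFibre.nonempty_algEquiv_of_finrank_eq_two (M := K (e c m)) (h2c c) hF2 (by rw [h6 c m]; decide) (i c m).toRatAlgHom F.val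
  exact (hne c c' m m' hcc).2.false (g.comp φ.toRingEquiv.toRingHom)

end Family

end Summit.HodgeConjecture.CorCM.MultiFieldWeil

end
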